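import Literature.Barriers.RiemannHypothesis.EpsteinZetaRealZerosNearOne
import Literature.NumberTheory.LFunctions.SiegelZeroClassNumberAllConductors
import HarnessLib

/-!
# The central-value nonnegativity exit (II.X), kernel: `L(½, χ) ≥ 0` for the odd real primitive `χ` mod `d`
# forces `h(−d) ≥ 1 + d^{1/4}(log d − 2 log 2 − 4)/(4√2)`; hence a class number below that bound — in
# particular a Siegel zero of quality `η ≳ d^{1/4}` — forces a NEGATIVE central value `L(½, χ) < 0`

Topic `Literature/NumberTheory/LFunctions` (namespace `Literature.NumberTheory.LFunctions`, sub-namespace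
`CentralValueExit`). Everything in this file is PROVED (theorems only; no definition, no named fact, debt 0).
Cell `parity-realchar` (SIEGEL INSTRUMENT, conditionals column (3)): Direction II, candidate topic II.X
«central-value NON-NEGATIVITY exit», which the list of record kept INDEX-ONLY because no held source prints it
as a numbered theorem (Iwaniec, *Conversations on the exceptional character*, LNM 1891 (2006), (4.23)–(4.25):
"`L(½, χ_D) ≥ 0` ⇒ `h(−D) ≫ D^{1/4} log D`, effective", after Iwaniec–Kowalski (22.60)); a kernel proof
needs no locator, and here is one, with explicit constants.

## The statement and the proof

Let `χ` be the odd real primitive character mod `d > 4`, i.e. the Kronecker character of the imaginary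
quadratic field `K` of discriminant `−d` (Montgomery–Vaughan Thm 9.13; tree
`Quadratic.exists_quadraticField_of_odd_primitive`), `h = h(−d) = h_K` (tree
`Quadratic.card_reducedForms_eq_classNumber`). Dirichlet's decomposition over the reduced forms `Q = (a, b, c)`
of discriminant `−d`,
`ζ(s) L(s, χ) = ½ Σ_Q Z_Q(s)`, `Z_Q(s) = Σ'_{(m,n)} Q(m, n)^{−s}`
(tree: `Literature.Barriers.RiemannHypothesis.riemannZeta_mul_LFunction_eq_half_sum_of_one_lt_re`, `Re s > 1`),
continues to `ℂ ∖ {1}` (identity theorem, each `Z_Q` continued by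
`MontgomeryVaughan2007_epsteinContinuation_holds`), in particular to `s = ½`. On `(0, 1)` every continuation is
`Z_Q(σ) = c_d(σ) Λ_{z_Q}(σ)` with the SAME positive factor `c_d(σ) = π^σ (√d/2)^{−σ}/Γ(σ)` for all forms of
discriminant `−d` and `Λ_z = Λ₀,z − 1/s − 1/(1−s)` the Mellin transform of the lattice theta series at
`z_Q = (b + i√d)/(2a)`, `Im z_Q = √d/(2a)` (tree `EpsteinZetaCentralValue.continuation_ofReal_eq`,
`exists_zQ'`). Two kernel bounds at `σ = ½`:

* every class: `Re Λ_z(½) = Re Λ₀,z(½) − 4 ≥ −4`, because the Mellin integrand of `Λ₀,z` is non-negative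
  (`re_f_modif_nonneg`: `Θ_z(t) ≥ max(1, 1/t)`) — `re_thetaΛ_half_ge_neg_four`;
* the principal class (`a = 1`, `Im z = √d/2`): `Re Λ_z(½) ≥ 2√y (log y − 2)`, `y = √d/2` (tree
  `re_Λ_half_ge`, Riemann's integral minus the dropped theta terms; Bateman–Grosswald (9) has the exact
  `2√y(γ + log y − log 4π) + O(e^{−2πy})`).

Since `ζ(½) < 0` (tree `riemannZeta_re_neg_of_pos_of_lt_one`) and `L(½, χ)` is real, **`L(½, χ) ≥ 0` gives
`Σ_Q Re Λ_{z_Q}(½) ≤ 0`, i.e. `2√y(log y − 2) ≤ 4(h − 1)`:**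

* `bqfClassNumber_ge_of_LFunction_half_nonneg` / `classNumber_ge_of_LFunction_half_nonneg`
  **`h(−d) ≥ 1 + ½ √(√d/2) (log(√d/2) − 2) = 1 + d^{1/4}(log d − 2 log 2 − 4)/(4√2)`**
  (form side `BinaryQuadraticForm.classNumber (−d)` and field side `NumberField.classNumber K` for every
  quadratic `K` with `d_K = −d`); `classNumber_gt_of_LFunction_half_nonneg_of_ge`: `h_K > d^{1/4} log d/(8√2)`
  for `d ≥ 6·10⁴`;
* CONTRAPOSITIVE (Direction I row): `LFunction_half_neg_of_classNumber_lt` — **a class number below the bound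
  forces `L(½, χ) < 0`**, hence (`exists_realZero_gt_half_of_classNumber_lt`, intermediate value theorem with
  `L(1, χ) > 0`) **a real zero of `L(s, χ)` in `(½, 1)`**; on the column's predicate, `LFunction_half_neg_of_isSiegelZero`: **a Tao–Teräväinen
  Siegel zero of quality `η ≥ 40` with `η · (1 + d^{1/4}(log d − 2 log 2 − 4)/(4√2)) > √d log d/π` (so
  `η ≳ (4√2/π) d^{1/4}`) forces `L(½, χ) < 0`** (via the kernel I.1 ceiling `h_K ≤ √d log d/(π η)`,
  `SiegelZeroClassNumber.classNumber_le_of_isSiegelZero_odd_of_forty_le`) — the central value of the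
  exceptional character is NEGATIVE, a second violation of GRH riding on the first;
* in `L(1)`-currency (class number formula `L(1,χ) = π h_K/√d`, tree `SiegelZeroClassNumber.lOne_re_eq_of_odd`):
  `lOne_ge_of_LFunction_half_nonneg` **`L(1, χ) ≥ π (1 + d^{1/4}(log d − 2 log 2 − 4)/(4√2))/√d`** — the
  effective `d^{−1/4} log d` floor (unconditionally only Goldfeld–Gross–Zagier's `log d/√d` scale is effective);
* repulsion: `one_sub_realZero_ge_of_LFunction_half_nonneg` — with the kernel (11.10) ceiling
  `h_K ≤ (1/π)√d log²d (1 − β)` (window `1/(40 log d)`, `d ≥ 232`): **every real zero has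
  `1 − β ≥ π(1 + d^{1/4}(log d − 2 log 2 − 4)/(4√2))/(√d log²d)`**, i.e. `1 − β ≫ 1/(d^{1/4} log d)` instead of
  the unconditional kernel `π/(√d log²d)`; `isSiegelZero_quality_le_of_LFunction_half_nonneg`: quality
  `η ≤ √d log d/(π(1 + …))`.

What `L(½, χ) ≥ 0` does NOT give: `1 − β ≫ 1/log d` (no exclusion of Siegel zeros of bounded quality; the
predicate `UnboundedSiegelZeros` is untouched) — the exit closes only POWER-quality exceptional zeros, as the
index line of the list of record says ("a GRH consequence far weaker than GRH"). Even conductors / real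
quadratic fields: not treated (the Epstein decomposition of the tree is for `d_K < −4`).

## Normalisation bookkeeping and comparison with print (cell owner's request, 2026-08-27)

* The hypothesis `d > 4` is exactly `d_K < −4`, i.e. `w_K = 2` roots of unity: this is where the `½` in
  `ζ_K(s) = ½ Σ_{Q reduced} Z_Q(s)` comes from (`Z_Q` runs over all `(m, n) ≠ (0, 0)`, each ideal of a class being
  hit `w_K = 2` times; tree `Quadratic.dedekindZeta_eq_half_sum_epsteinZeta`, Zagier §8 / Cox Thm 7.7). The two
  discriminants `d = 3, 4` (`w = 6, 4`) are outside every statement below; there `h = 1` (kernel tables).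
* Reduced forms ↔ ideal classes: the sum runs over `BinaryQuadraticForm.reducedForms (−d)`, whose cardinality is
  `BinaryQuadraticForm.classNumber (−d) = NumberField.classNumber K` for EVERY quadratic field `K` with `d_K = −d`
  (tree `Quadratic.reducedForms_mk0_bijective`, `Quadratic.card_reducedForms_eq_classNumber`; Cox Thm 2.8/7.7(ii)) —
  this is the only place where the field enters; the principal form `BinaryQuadraticForm.principalForm (−d)` is a
  member (`principalForm_mem_reducedForms`, using `d_K ≡ 0, 1 (mod 4)`).
* The factor `c_d(½) = π^{1/2}(√d/2)^{−1/2}/Γ(½) = (2/√d)^{1/2} > 0` relating `Z_Q(½)` to `Λ_{z_Q}(½)` depends only on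
  `d` (tree `continuation_ofReal_eq`, `realFactor_pos`), so it factors out of the class sum and only its SIGN is used.
* Constants: Iwaniec–Kowalski (22.60) and Iwaniec 2006 (4.25) print `h(−D) ≫ D^{1/4} log D` with NO constant. The
  `1/(4√2)` (equivalently `½√(√d/2)(log(√d/2) − 2)`) and the `−4` per non-principal class are the TREE's: the first
  is `re_Λ_half_ge` (which drops `γ + 2 − log 4π ≈ 0.046` and the non-negative theta terms `m ≠ 0` from
  Bateman–Grosswald's exact (9)), the second is `Λ₀ ≥ 0` (which drops the whole Mellin integral). No claim of matching
  or optimising any printed constant; the true minimum of `Re Λ_z(½)` over reduced points is about `−3.9` (at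
  `y = √3/2`, by (9)), so `−4` is nearly sharp, while the principal term loses only `0.046·2√y`.

LABEL (cell rule): conditionals II.X (exit) + I-row (Siegel zero ⇒ negative central value), kernel, fact-free.
WHAT THIS IS NOT: no claim about the sign of any actual central value; nothing here bears on parity (H5).

## References (context; nothing is cited as a source of a named fact)

* [IwaniecConversations2006] H. Iwaniec, *Conversations on the exceptional character*, in: Analytic Number
  Theory (Cetraro 2002), LNM 1891 (2006) 97–132, §4 (4.23)–(4.25) (the implication in the shape
  `h(−D) ≫ D^{1/4} log D`; derivation sketched from the Fourier expansion of the Eisenstein series).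
* [BatemanGrosswald1964] P. T. Bateman, E. Grosswald, *On Epstein's zeta function*, Acta Arith. 9 (1964)
  365–373, Theorem 3 (9)–(11) (the central value of one class).
* [GranvilleStark2000] A. Granville, H. M. Stark, Invent. Math. 139 (2000), §3.2 (the class decomposition).
* [MontgomeryVaughan2007] §9.3 Theorem 9.13; §10.1 Exercise 25; §11.2 (11.10).
* [TaoTeravainen2021] Definition 1.4 (`IsSiegelZero`).
-/

noncomputable section

open Complex Filter Topology MeasureTheory Set
open scoped UpperHalfPlane
open Literature.Barriers.RiemannHypothesis
open Literature.Barriers.Parity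
open Literature.NumberTheory.Automorphic
open Literature.NumberTheory.QuadraticFields Literature.NumberTheory.QuadraticFields.Quadratic
open Literature.NumberTheory.QuadraticFields.BinaryQuadraticForm (reducedForms mem_reducedForms_iff
  le_of_isReduced discr_apply principalForm principalForm_mem_reducedForms principalForm_fst)
open _root_.NumberField Module

namespace Literature.NumberTheory.LFunctions

namespace CentralValueExit

/-! ### The Epstein side at `s = ½` -/

/-- **Every lattice: `Re Λ_z(½) ≥ −4`.** `Λ_z(½) = Λ₀,z(½) − 1/(½) − 1/(1 − ½)` and
`Re Λ₀,z(½) = ∫₀^∞ t^{−½} Re f̃_z(t) dt ≥ 0` (the Mellin integrand `f̃_z = 𝟙_{(1,∞)}(Θ_z − 1) + 𝟙_{(0,1)}(Θ_z − 1/t)`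
is non-negative since `Θ_z(t) ≥ max(1, 1/t)`). This is the one-sided, numerics-free shadow — valid for EVERY
`z ∈ ℍ` — of Bateman–Grosswald's exact central value (9) `Λ_z(½) = 2√y(γ + log y − log 4π) + 4θe^{−2πy}`
(`|θ| < 1`, `y ≥ √3/2`), whose right side is indeed `> −4`. [cite: BatemanGrosswald1964, Theorem 3 (9)] -/
theorem re_thetaΛ_half_ge_neg_four (z : ℍ) : -4 ≤ ((thetaFEPair z).Λ ((1 / 2 : ℝ) : ℂ)).re := by
  have h0 : 0 ≤ ((thetaFEPair z).Λ₀ ((1 / 2 : ℝ) : ℂ)).re := by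
    rw [re_Λ₀_eq_integral]
    refine setIntegral_nonneg measurableSet_Ioi fun t ht => ?_
    exact mul_nonneg (Real.rpow_nonneg (le_of_lt ht) _) (re_f_modif_nonneg z ht)
  have e := re_Λ_ofReal z (1 / 2)
  rw [e]
  have h4 : (1 : ℝ) / (1 / 2) + 1 / (1 - 1 / 2) = 4 := by norm_num
  linarith

/-- The positive factor at `σ = ½` attached to the discriminant `d`: `c_d(½) = π^{1/2}(√d/2)^{−1/2}/Γ(½) > 0`.
[folklore] -/
private theorem halfFactor_pos {d : ℕ} (hd : 4 < d) :
    0 < Real.pi ^ (1 / 2 : ℝ) * (Real.sqrt d / 2) ^ (-(1 / 2 : ℝ)) / Real.Gamma (1 / 2) := by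
  have hd0 : (0 : ℝ) < d := by exact_mod_cast (show 0 < d by omega)
  have h1 : 0 < Real.pi ^ (1 / 2 : ℝ) := Real.rpow_pos_of_pos Real.pi_pos _
  have h2 : 0 < (Real.sqrt d / 2) ^ (-(1 / 2 : ℝ)) :=
    Real.rpow_pos_of_pos (by positivity) _
  have h3 := Real.Gamma_pos_of_pos (show (0 : ℝ) < 1 / 2 by norm_num)
  positivity

/-- **A reduced class at `s = ½`.** For `(a, b, c)` a reduced form of discriminant `−d` (`d > 4`) and ANY
analytic continuation `Z` of `ζ_Q`: `Z(½) = c_d(½) · Λ_z(½)` with `z = (b + i√d)/(2a)` (`Im z = √d/(2a)`), so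
`Re Z(½) ≥ −4 c_d(½)` — the one-sided kernel form of Bateman–Grosswald's Theorem 3 ((9), (11): the sign and
size of `Z(½)` as a function of `k = √|d|/(2a)`). [cite: BatemanGrosswald1964, Theorem 3 (9) and (11)] -/
theorem re_half_ge_of_mem_reducedForms {d : ℕ} (hd : 4 < d) {a b c : ℤ}
    (hQ : (a, b, c) ∈ reducedForms (-(d : ℤ))) {Z : ℂ → ℂ}
    (hZ : IsEpsteinContinuation (a : ℝ) (b : ℝ) (c : ℝ) Z) :
    -(4 * (Real.pi ^ (1 / 2 : ℝ) * (Real.sqrt d / 2) ^ (-(1 / 2 : ℝ)) / Real.Gamma (1 / 2))) ≤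
      (Z (1 / 2)).re := by
  have hD0 : (-(d : ℤ)) < 0 := by omega
  obtain ⟨hdisc, ha, -, hred⟩ := (mem_reducedForms_iff hD0).1 hQ
  simp only at ha
  rw [discr_apply] at hdisc
  have hdR : (4 : ℝ) * c * a - (b : ℝ) ^ 2 = d := by
    exact_mod_cast (by linarith : 4 * c * a - b ^ 2 = (d : ℤ))
  have hd4R : (4 : ℝ) < d := by exact_mod_cast hd
  have hpos : IsPosDefForm (a : ℝ) (b : ℝ) (c : ℝ) := ⟨by exact_mod_cast ha, by linarith⟩
  obtain ⟨z, hre, him, -⟩ := exists_zQ' hpos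
  have hZ' : IsEpsteinContinuation (c : ℝ) (b : ℝ) (a : ℝ) Z :=
    (isEpsteinContinuation_swap_iff (a : ℝ) (b : ℝ) (c : ℝ) Z).2 hZ
  have hhalf : ((1 / 2 : ℝ) : ℂ) = 1 / 2 := by push_cast; rfl
  have e := continuation_ofReal_eq hpos.swap z hre him hZ' (σ := 1 / 2) (by norm_num) (by norm_num)
  rw [hhalf] at e
  rw [e, Complex.re_ofReal_mul, hdR]
  have hF := halfFactor_pos hd
  have hΛ := re_thetaΛ_half_ge_neg_four z
  rw [hhalf] at hΛ
  have := mul_le_mul_of_nonneg_left hΛ hF.le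
  linarith

/-- **The principal class at `s = ½`.** For the reduced form `(1, b, c)` of discriminant `−d` (`d > 4`):
`Im z = √d/2 ≥ 1`, so `Re Z(½) ≥ c_d(½) · 2√(√d/2)(log(√d/2) − 2)` (tree `re_Λ_half_ge`).
[cite: BatemanGrosswald1964, Theorem 3 (9)] -/
theorem re_half_ge_of_mem_reducedForms_principal {d : ℕ} (hd : 4 < d) {b c : ℤ}
    (hQ : ((1 : ℤ), b, c) ∈ reducedForms (-(d : ℤ))) {Z : ℂ → ℂ}
    (hZ : IsEpsteinContinuation ((1 : ℤ) : ℝ) (b : ℝ) (c : ℝ) Z) :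
    (Real.pi ^ (1 / 2 : ℝ) * (Real.sqrt d / 2) ^ (-(1 / 2 : ℝ)) / Real.Gamma (1 / 2)) *
        (2 * Real.sqrt (Real.sqrt d / 2) * (Real.log (Real.sqrt d / 2) - 2)) ≤ (Z (1 / 2)).re := by
  have hD0 : (-(d : ℤ)) < 0 := by omega
  obtain ⟨hdisc, ha, -, hred⟩ := (mem_reducedForms_iff hD0).1 hQ
  rw [discr_apply] at hdisc
  have hdR : (4 : ℝ) * c * (1 : ℤ) - (b : ℝ) ^ 2 = d := by
    exact_mod_cast (by linarith : 4 * c * 1 - b ^ 2 = (d : ℤ))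
  have hd4R : (4 : ℝ) < d := by exact_mod_cast hd
  have hpos : IsPosDefForm ((1 : ℤ) : ℝ) (b : ℝ) (c : ℝ) :=
    ⟨by exact_mod_cast one_pos, by push_cast at hdR ⊢; linarith⟩
  obtain ⟨z, hre, him, -⟩ := exists_zQ' hpos
  have hZ' : IsEpsteinContinuation (c : ℝ) (b : ℝ) ((1 : ℤ) : ℝ) Z :=
    (isEpsteinContinuation_swap_iff ((1 : ℤ) : ℝ) (b : ℝ) (c : ℝ) Z).2 hZ
  have hhalf : ((1 / 2 : ℝ) : ℂ) = 1 / 2 := by push_cast; rfl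
  have e := continuation_ofReal_eq hpos.swap z hre him hZ' (σ := 1 / 2) (by norm_num) (by norm_num)
  rw [hhalf] at e
  rw [e, Complex.re_ofReal_mul, hdR]
  have hF := halfFactor_pos hd
  -- `Im z = √d/2 ≥ 1`
  have hy : z.im = Real.sqrt d / 2 := by
    rw [him, hdR]; push_cast; ring
  have hsd : 2 ≤ Real.sqrt d := (Real.le_sqrt' two_pos).2 (by linarith)
  have hy1 : 1 ≤ z.im := by rw [hy]; linarith
  have hΛ := re_Λ_half_ge z hy1
  rw [hy, hhalf] at hΛ
  exact mul_le_mul_of_nonneg_left hΛ hF.le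

/-! ### The class sum at `s = ½` and the class number bound -/

/-- **`L(½, χ) ≥ 0 ⇒ h(−d) ≥ 1 + ½ √(√d/2)(log(√d/2) − 2)`** (form side: `h(−d)` = the number of reduced
primitive positive definite forms of discriminant `−d`), for the odd real primitive character `χ` mod `d > 4`.
Proof: continue `ζ(s)L(s,χ) = ½ Σ_Q Z_Q(s)` to `s = ½`; `ζ(½) < 0`, `L(½,χ) ≥ 0` make the left side `≤ 0`,
while the right side is at least `½ c_d(½) (2√y(log y − 2) − 4(h − 1))`, `y = √d/2`. This is Iwaniec's
(4.23)–(4.25) («`L(½, χ_D) ≥ 0` ⇒ `h(−D) ≫ D^{1/4} log D`») with explicit constants, in the `√`-form.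
[cite: IwaniecConversations2006, §4 (4.23)–(4.25)] -/
theorem bqfClassNumber_ge_of_LFunction_half_nonneg {d : ℕ} [NeZero d] (hd : 4 < d)
    {χ : DirichletCharacter ℂ d} (hprim : χ.IsPrimitive) (hquad : χ.IsQuadratic) (hodd : χ.Odd)
    (hL : 0 ≤ (χ.LFunction (1 / 2)).re) :
    1 + Real.sqrt (Real.sqrt d / 2) * (Real.log (Real.sqrt d / 2) - 2) / 2 ≤
      (BinaryQuadraticForm.classNumber (-(d : ℤ)) : ℝ) := by
  classical
  have hd4R : (4 : ℝ) < d := by exact_mod_cast hd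
  have hD0 : (-(d : ℤ)) < 0 := by omega
  have hχ1 : χ ≠ 1 := by
    intro h
    have h1 : χ (-1) = -1 := hodd
    rw [h, MulChar.one_apply (isUnit_one.neg)] at h1
    norm_num at h1
  set S := reducedForms (-(d : ℤ)) with hS
  -- continuations of the class zeta functions
  have hex : ∀ Q : ℤ × ℤ × ℤ, ∃ Z : ℂ → ℂ,
      Q ∈ S → IsEpsteinContinuation (Q.1 : ℝ) (Q.2.1 : ℝ) (Q.2.2 : ℝ) Z := by
    intro Q
    by_cases hQ : Q ∈ S
    · obtain ⟨hdisc, ha, -, hred⟩ := (mem_reducedForms_iff hD0).1 hQ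
      rw [show Q = (Q.1, Q.2.1, Q.2.2) from rfl, discr_apply] at hdisc
      have hpos : IsPosDefForm (Q.1 : ℝ) (Q.2.1 : ℝ) (Q.2.2 : ℝ) := by
        refine ⟨by exact_mod_cast ha, ?_⟩
        have : (Q.2.1 : ℝ) ^ 2 - 4 * (Q.1 : ℝ) * (Q.2.2 : ℝ) = ((-(d : ℤ) : ℤ) : ℝ) := by
          exact_mod_cast hdisc
        rw [this]; push_cast; linarith
      obtain ⟨Z, hZ, -⟩ := MontgomeryVaughan2007_epsteinContinuation_holds _ _ _ hpos
      exact ⟨Z, fun _ => hZ⟩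
    · exact ⟨0, fun h => absurd h hQ⟩
  choose Z hZ using hex
  set G : ℂ → ℂ := fun s => 1 / 2 * ∑ Q ∈ S, Z Q s with hGdef
  set F : ℂ → ℂ := fun s => riemannZeta s * χ.LFunction s with hFdef
  -- both sides are analytic on `ℂ ∖ {1}` and agree on `Re s > 1`
  have hU : IsOpen {s : ℂ | s ≠ 1} := isOpen_ne
  have hFd : DifferentiableOn ℂ F {s : ℂ | s ≠ 1} := fun s hs =>
    ((differentiableAt_riemannZeta hs).mul
      ((DirichletCharacter.differentiable_LFunction hχ1) s)).differentiableWithinAt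
  have hGd : DifferentiableOn ℂ G {s : ℂ | s ≠ 1} :=
    (differentiableOn_const _).mul (DifferentiableOn.fun_sum fun Q hQ => (hZ Q hQ).1)
  have hFG : EqOn F G {s : ℂ | s ≠ 1} := by
    refine (hFd.analyticOnNhd hU).eqOn_of_preconnected_of_eventuallyEq (hGd.analyticOnNhd hU)
      isPreconnected_compl_one (show (2 : ℂ) ∈ {s : ℂ | s ≠ 1} by norm_num) ?_
    have hopen : IsOpen {s : ℂ | 1 < s.re} := isOpen_lt continuous_const Complex.continuous_re
    filter_upwards [hopen.mem_nhds (show (2 : ℂ) ∈ {s : ℂ | 1 < s.re} by simp)] with s hs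
    have hs' : 1 < s.re := hs
    simp only [hFdef, hGdef]
    rw [riemannZeta_mul_LFunction_eq_half_sum_of_one_lt_re hd hprim hquad hodd hs']
    congr 1
    exact Finset.sum_congr rfl fun Q hQ => ((hZ Q hQ).2 s hs').symm
  -- at `s = ½`
  have hU2 : ((1 : ℂ) / 2) ∈ {s : ℂ | s ≠ 1} := by
    simp only [Set.mem_setOf_eq]; norm_num
  have heq := hFG hU2
  simp only [hFdef, hGdef] at heq
  -- the left side is `≤ 0`
  have hhalf : ((1 / 2 : ℝ) : ℂ) = 1 / 2 := by push_cast; rfl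
  have hζim : (riemannZeta (1 / 2)).im = 0 := by
    rw [← hhalf]; exact riemannZeta_im_eq_zero_of_pos (by norm_num) (by norm_num)
  have hζre : (riemannZeta (1 / 2)).re < 0 := by
    rw [← hhalf]; exact riemannZeta_re_neg_of_pos_of_lt_one (by norm_num) (by norm_num)
  have hLHS : (riemannZeta (1 / 2) * χ.LFunction (1 / 2)).re ≤ 0 := by
    rw [Complex.mul_re, hζim, zero_mul, sub_zero]
    exact mul_nonpos_of_nonpos_of_nonneg hζre.le hL
  rw [heq] at hLHS
  -- the right side, class by class
  set κ : ℝ := Real.pi ^ (1 / 2 : ℝ) * (Real.sqrt d / 2) ^ (-(1 / 2 : ℝ)) / Real.Gamma (1 / 2) with hκ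
  have hκ0 : 0 < κ := halfFactor_pos hd
  set y : ℝ := Real.sqrt d / 2 with hy
  -- the principal form is a reduced form with first coefficient `1`
  have h4 : (-(d : ℤ)) % 4 = 0 ∨ (-(d : ℤ)) % 4 = 1 := by
    obtain ⟨K, _i1, _i2, h2, hdisc⟩ := exists_quadraticField_of_odd_primitive hprim hquad hodd
    obtain ⟨bK, hbK⟩ := exists_basis_zero_eq_one h2
    have hD := discr_eq_sq_add_four_mul bK hbK
    rw [hdisc] at hD
    set t : ℤ := bK.repr (bK 1 * bK 1) 1
    set m : ℤ := bK.repr (bK 1 * bK 1) 0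
    rw [hD]
    obtain ⟨k, hk | hk⟩ := Int.even_or_odd' t
    · left
      rw [hk, show (2 * k) ^ 2 + 4 * m = 4 * (k ^ 2 + m) by ring]
      exact Int.mul_emod_right _ _
    · right
      rw [hk, show (2 * k + 1) ^ 2 + 4 * m = 1 + 4 * (k ^ 2 + k + m) by ring, Int.add_mul_emod_self_left]
      norm_num
  set P : ℤ × ℤ × ℤ := principalForm (-(d : ℤ)) with hP
  have hPS : P ∈ S := principalForm_mem_reducedForms hD0 h4
  have hP1 : P.1 = 1 := principalForm_fst _
  -- lower bounds for the terms
  have hterm : ∀ Q ∈ S, -(4 * κ) ≤ (Z Q (1 / 2)).re := fun Q hQ =>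
    re_half_ge_of_mem_reducedForms hd (a := Q.1) (b := Q.2.1) (c := Q.2.2) hQ (hZ Q hQ)
  have hmain : κ * (2 * Real.sqrt y * (Real.log y - 2)) ≤ (Z P (1 / 2)).re := by
    have hQ' : ((1 : ℤ), P.2.1, P.2.2) ∈ S := by
      have : P = (P.1, P.2.1, P.2.2) := rfl
      rw [this, hP1] at hPS
      exact hPS
    have hZP := hZ P hPS
    rw [hP1] at hZP
    exact re_half_ge_of_mem_reducedForms_principal hd hQ' hZP
  -- summing
  have hcard : S.card = BinaryQuadraticForm.classNumber (-(d : ℤ)) := rfl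
  have h1S : 1 ≤ S.card := Finset.card_pos.2 ⟨P, hPS⟩
  have hsum : κ * (2 * Real.sqrt y * (Real.log y - 2)) + ((S.card : ℝ) - 1) * (-(4 * κ)) ≤
      ∑ Q ∈ S, (Z Q (1 / 2)).re := by
    rw [← Finset.add_sum_erase S (fun Q => (Z Q (1 / 2)).re) hPS]
    refine add_le_add hmain ?_
    have hle : ∑ _Q ∈ S.erase P, (-(4 * κ)) ≤ ∑ Q ∈ S.erase P, (Z Q (1 / 2)).re :=
      Finset.sum_le_sum fun Q hQ => hterm Q (Finset.mem_of_mem_erase hQ)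
    rw [Finset.sum_const, nsmul_eq_mul, Finset.card_erase_of_mem hPS, Nat.cast_sub h1S,
      Nat.cast_one] at hle
    exact hle
  have hre : (1 / 2 * ∑ Q ∈ S, Z Q (1 / 2)).re = 1 / 2 * ∑ Q ∈ S, (Z Q (1 / 2)).re := by
    rw [show (1 : ℂ) / 2 = ((1 / 2 : ℝ) : ℂ) by push_cast; ring, Complex.re_ofReal_mul, Complex.re_sum]
  rw [hre] at hLHS
  -- conclude
  rw [← hcard]
  have hkey : κ * (2 * Real.sqrt y * (Real.log y - 2) - 4 * ((S.card : ℝ) - 1)) ≤ 0 := by nlinarith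
  have hkey' : 2 * Real.sqrt y * (Real.log y - 2) - 4 * ((S.card : ℝ) - 1) ≤ 0 := by
    by_contra hcon
    push Not at hcon
    have := mul_pos hκ0 hcon
    linarith
  linarith

/-- `√(√d/2) = d^{1/4}/√2` and `log(√d/2) = ½ log d − log 2`: the bound rewritten,
`½ √(√d/2)(log(√d/2) − 2) = d^{1/4}(log d − 2 log 2 − 4)/(4√2)`. [folklore] -/
private theorem sqrt_form_eq_rpow_form {d : ℕ} (hd : 4 < d) :
    Real.sqrt (Real.sqrt d / 2) * (Real.log (Real.sqrt d / 2) - 2) / 2 =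
      (d : ℝ) ^ (1 / 4 : ℝ) * (Real.log d - 2 * Real.log 2 - 4) / (4 * Real.sqrt 2) := by
  have hd0 : (0 : ℝ) < d := by exact_mod_cast (show 0 < d by omega)
  have hsd0 : 0 < Real.sqrt d := Real.sqrt_pos.2 hd0
  have hs2 : 0 < Real.sqrt 2 := Real.sqrt_pos.2 two_pos
  have h1 : Real.sqrt (Real.sqrt d / 2) = (d : ℝ) ^ (1 / 4 : ℝ) / Real.sqrt 2 := by
    rw [Real.sqrt_div' _ (by norm_num : (0 : ℝ) ≤ 2), Real.sqrt_eq_rpow, Real.sqrt_eq_rpow,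
      ← Real.rpow_mul hd0.le]
    norm_num
  have h2 : Real.log (Real.sqrt d / 2) = Real.log d / 2 - Real.log 2 := by
    rw [Real.log_div hsd0.ne' two_ne_zero, Real.log_sqrt hd0.le]
  rw [h1, h2]
  field_simp
  ring

/-- **`L(½, χ) ≥ 0 ⇒ h(−d) ≥ 1 + d^{1/4}(log d − 2 log 2 − 4)/(4√2)`** (form side), `χ` the odd real primitive
character mod `d > 4`. This is the «central-value nonnegativity exit» in the shape `h(−D) ≫ D^{1/4} log D`
of Iwaniec 2006 (4.25), with explicit constants, proved in the kernel from the Epstein class decomposition.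
[cite: IwaniecConversations2006, §4 (4.23)–(4.25)] -/
theorem bqfClassNumber_ge_rpow_of_LFunction_half_nonneg {d : ℕ} [NeZero d] (hd : 4 < d)
    {χ : DirichletCharacter ℂ d} (hprim : χ.IsPrimitive) (hquad : χ.IsQuadratic) (hodd : χ.Odd)
    (hL : 0 ≤ (χ.LFunction (1 / 2)).re) :
    1 + (d : ℝ) ^ (1 / 4 : ℝ) * (Real.log d - 2 * Real.log 2 - 4) / (4 * Real.sqrt 2) ≤
      (BinaryQuadraticForm.classNumber (-(d : ℤ)) : ℝ) := by
  rw [← sqrt_form_eq_rpow_form hd]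
  exact bqfClassNumber_ge_of_LFunction_half_nonneg hd hprim hquad hodd hL

variable {K : Type*} [Field K] [NumberField K]

/-- **`L(½, χ) ≥ 0 ⇒ h_K ≥ 1 + |d_K|^{1/4}(log|d_K| − 2 log 2 − 4)/(4√2)`** (field side) for every imaginary
quadratic field `K` with `d_K = −d` and `χ` the odd real primitive character mod `d > 4` (the Kronecker
character of `K`): `h(−d) = h_K` (tree `Quadratic.card_reducedForms_eq_classNumber`, Cox Thm 7.7).
[cite: IwaniecConversations2006, §4 (4.23)–(4.25)] -/
theorem classNumber_ge_of_LFunction_half_nonneg (h2 : finrank ℚ K = 2) {d : ℕ} [NeZero d]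
    (hdK : NumberField.discr K = -(d : ℤ)) (hd : 4 < d) {χ : DirichletCharacter ℂ d}
    (hprim : χ.IsPrimitive) (hquad : χ.IsQuadratic) (hodd : χ.Odd)
    (hL : 0 ≤ (χ.LFunction (1 / 2)).re) :
    1 + (d : ℝ) ^ (1 / 4 : ℝ) * (Real.log d - 2 * Real.log 2 - 4) / (4 * Real.sqrt 2) ≤
      (classNumber K : ℝ) := by
  have hdneg : NumberField.discr K < 0 := by rw [hdK]; omega
  have hh := card_reducedForms_eq_classNumber h2 hdneg
  rw [hdK] at hh
  have := bqfClassNumber_ge_rpow_of_LFunction_half_nonneg hd hprim hquad hodd hL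
  rw [hh] at this
  exact this

/-- Numerics: `2 log 2 + 4 < 5.3863`. [folklore] -/
private theorem two_log_two_add_four_lt : 2 * Real.log 2 + 4 < 5.3863 := by
  have := Real.log_two_lt_d9
  linarith

/-- **A cleaner corollary: for `d ≥ 6·10⁴` (so that `log d ≥ 11 > 2·5.3863`), `L(½, χ) ≥ 0 ⇒ h_K > d^{1/4} log d/(8√2)`**
(`> 0.088 · d^{1/4} log d`). [cite: IwaniecConversations2006, §4 (4.25)] -/
theorem classNumber_gt_of_LFunction_half_nonneg_of_ge (h2 : finrank ℚ K = 2) {d : ℕ} [NeZero d]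
    (hdK : NumberField.discr K = -(d : ℤ)) (hd : 6 * 10 ^ 4 ≤ d) {χ : DirichletCharacter ℂ d}
    (hprim : χ.IsPrimitive) (hquad : χ.IsQuadratic) (hodd : χ.Odd)
    (hL : 0 ≤ (χ.LFunction (1 / 2)).re) :
    (d : ℝ) ^ (1 / 4 : ℝ) * Real.log d / (8 * Real.sqrt 2) < (classNumber K : ℝ) := by
  have hd4 : 4 < d := by omega
  have hmain := classNumber_ge_of_LFunction_half_nonneg h2 hdK hd4 hprim hquad hodd hL
  have hdR : (6 * 10 ^ 4 : ℝ) ≤ d := by exact_mod_cast hd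
  have hd0 : (0 : ℝ) < d := by linarith
  -- `log d ≥ 11`
  have hlog : 11 ≤ Real.log d := by
    rw [Real.le_log_iff_exp_le hd0]
    have h := Real.exp_one_lt_d9
    have h11 : Real.exp 11 = Real.exp 1 ^ 11 := by rw [← Real.exp_nat_mul]; norm_num
    rw [h11]
    have : Real.exp 1 ^ 11 < 2.7182818286 ^ 11 := by gcongr
    linarith [show (2.7182818286 : ℝ) ^ 11 < 6 * 10 ^ 4 by norm_num]
  have hl2 := two_log_two_add_four_lt
  have hr0 : 0 < (d : ℝ) ^ (1 / 4 : ℝ) := Real.rpow_pos_of_pos hd0 _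
  have hs2 : 0 < Real.sqrt 2 := Real.sqrt_pos.2 two_pos
  have hb : Real.log d / 2 ≤ Real.log d - 2 * Real.log 2 - 4 := by linarith
  have hstep : (d : ℝ) ^ (1 / 4 : ℝ) * Real.log d / (8 * Real.sqrt 2) =
      (d : ℝ) ^ (1 / 4 : ℝ) * (Real.log d / 2) / (4 * Real.sqrt 2) := by
    field_simp
    ring
  rw [hstep]
  have hstep' : (d : ℝ) ^ (1 / 4 : ℝ) * (Real.log d / 2) / (4 * Real.sqrt 2) ≤
      (d : ℝ) ^ (1 / 4 : ℝ) * (Real.log d - 2 * Real.log 2 - 4) / (4 * Real.sqrt 2) := by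
    gcongr
  linarith

/-! ### Direction I: a small class number, or a strong Siegel zero, forces a negative central value -/

/-- **CONTRAPOSITIVE: `h_K < 1 + d^{1/4}(log d − 2 log 2 − 4)/(4√2) ⇒ L(½, χ) < 0`** — an imaginary quadratic
field whose class number is below the `d^{1/4} log d` scale has a Kronecker character with NEGATIVE central
value (itself a violation of GRH for `L(s, χ)`, which would give `L(½, χ) ≥ 0`). (`L(½, χ)` is real for a
quadratic `χ` — tree `DirichletAbel.LFunction_ofReal_im_eq_zero` — so `Re L(½, χ) < 0` is `L(½, χ) < 0`.)
[cite: IwaniecConversations2006, §4 (4.23)–(4.25)] -/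
theorem LFunction_half_neg_of_classNumber_lt (h2 : finrank ℚ K = 2) {d : ℕ} [NeZero d]
    (hdK : NumberField.discr K = -(d : ℤ)) (hd : 4 < d) {χ : DirichletCharacter ℂ d}
    (hprim : χ.IsPrimitive) (hquad : χ.IsQuadratic) (hodd : χ.Odd)
    (hh : (classNumber K : ℝ) < 1 + (d : ℝ) ^ (1 / 4 : ℝ) * (Real.log d - 2 * Real.log 2 - 4) / (4 * Real.sqrt 2)) :
    (χ.LFunction (1 / 2)).re < 0 := by
  by_contra hcon
  push Not at hcon
  have := classNumber_ge_of_LFunction_half_nonneg h2 hdK hd hprim hquad hodd hcon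
  linarith

/-- **A Siegel zero of quality `η ≳ d^{1/4}` forces `L(½, χ) < 0`.** If the odd primitive quadratic `χ` mod
`d ≥ 10⁴` carries a Tao–Teräväinen Siegel zero of quality `η ≥ 40` (`L(1 − 1/(η log d), χ) = 0`) with
`η · (1 + d^{1/4}(log d − 2 log 2 − 4)/(4√2)) > √d log d/π`, then `L(½, χ) < 0`: the kernel I.1 ceiling
`h_K ≤ √d log d/(π η)` (`SiegelZeroClassNumber.classNumber_le_of_isSiegelZero_odd_of_forty_le`) puts `h_K` below
the bound of `classNumber_ge_of_LFunction_half_nonneg`. [cite: TaoTeravainen2021, Definition 1.4]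
[cite: IwaniecConversations2006, §4 (4.23)–(4.25)] -/
theorem LFunction_half_neg_of_isSiegelZero {d : ℕ} [NeZero d] (hd : 10 ^ 4 ≤ d)
    {χ : DirichletCharacter ℂ d} {η : ℝ} (hS : IsSiegelZero χ η) (hodd : χ.Odd) (h40 : 40 ≤ η)
    (hη : Real.sqrt d * Real.log d / Real.pi <
      η * (1 + (d : ℝ) ^ (1 / 4 : ℝ) * (Real.log d - 2 * Real.log 2 - 4) / (4 * Real.sqrt 2))) :
    (χ.LFunction (1 / 2)).re < 0 := by
  have hprim := hS.1
  have hquad := hS.2.1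
  obtain ⟨K, _i1, _i2, h2, hdK⟩ := exists_quadraticField_of_odd_primitive hprim hquad hodd
  have hη0 : 0 < η := by linarith
  have hup := SiegelZeroClassNumber.classNumber_le_of_isSiegelZero_odd_of_forty_le h2 hdK hd hS hodd h40
  refine LFunction_half_neg_of_classNumber_lt h2 hdK (by omega) hprim hquad hodd (lt_of_le_of_lt hup ?_)
  rw [show 1 / Real.pi * Real.sqrt d * Real.log d / η = Real.sqrt d * Real.log d / Real.pi / η by ring,
    div_lt_iff₀ hη0]
  linarith

/-- The same with the general Tao–Teräväinen threshold `η ≥ 10` (window `1/4`, constant `55`): if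
`η · (1 + d^{1/4}(log d − 2 log 2 − 4)/(4√2)) > 55 √d log d/π` then `L(½, χ) < 0`.
[cite: TaoTeravainen2021, Definition 1.4] [cite: IwaniecConversations2006, §4 (4.23)–(4.25)] -/
theorem LFunction_half_neg_of_isSiegelZero' {d : ℕ} [NeZero d] (hd : 10 ^ 4 ≤ d)
    {χ : DirichletCharacter ℂ d} {η : ℝ} (hS : IsSiegelZero χ η) (hodd : χ.Odd)
    (hη : 55 * Real.sqrt d * Real.log d / Real.pi <
      η * (1 + (d : ℝ) ^ (1 / 4 : ℝ) * (Real.log d - 2 * Real.log 2 - 4) / (4 * Real.sqrt 2))) :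
    (χ.LFunction (1 / 2)).re < 0 := by
  have hprim := hS.1
  have hquad := hS.2.1
  have h10 := hS.2.2.1
  obtain ⟨K, _i1, _i2, h2, hdK⟩ := exists_quadraticField_of_odd_primitive hprim hquad hodd
  have hη0 : 0 < η := by linarith
  have hup := (SiegelZeroClassNumber.classNumber_bounds_of_isSiegelZero_odd h2 hdK hd hS hodd).2
  refine LFunction_half_neg_of_classNumber_lt h2 hdK (by omega) hprim hquad hodd (lt_of_le_of_lt hup ?_)
  rw [show 55 / Real.pi * Real.sqrt d * Real.log d / η = 55 * Real.sqrt d * Real.log d / Real.pi / η by ring,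
    div_lt_iff₀ hη0]
  linarith

/-! ### `L(1)`-currency and repulsion under `L(½, χ) ≥ 0` -/

/-- **`L(½, χ) ≥ 0 ⇒ L(1, χ) ≥ π (1 + d^{1/4}(log d − 2 log 2 − 4)/(4√2))/√d`** — the effective `d^{−1/4} log d`
floor for `L(1, χ)` (class number formula `L(1, χ) = π h_K/√d`, tree `SiegelZeroClassNumber.lOne_re_eq_of_odd`).
[cite: IwaniecConversations2006, §4 (4.23)–(4.25)] [cite: NeukirchANT1999, Ch. VII §5 (5.11)] -/
theorem lOne_ge_of_LFunction_half_nonneg {d : ℕ} [NeZero d] (hd : 4 < d)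
    {χ : DirichletCharacter ℂ d} (hprim : χ.IsPrimitive) (hquad : χ.IsQuadratic) (hodd : χ.Odd)
    (hL : 0 ≤ (χ.LFunction (1 / 2)).re) :
    Real.pi * (1 + (d : ℝ) ^ (1 / 4 : ℝ) * (Real.log d - 2 * Real.log 2 - 4) / (4 * Real.sqrt 2)) /
        Real.sqrt d ≤ (χ.LFunction 1).re := by
  obtain ⟨K, _i1, _i2, h2, hdK⟩ := exists_quadraticField_of_odd_primitive hprim hquad hodd
  have hh := classNumber_ge_of_LFunction_half_nonneg h2 hdK hd hprim hquad hodd hL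
  rw [SiegelZeroClassNumber.lOne_re_eq_of_odd h2 hdK hd hprim hquad hodd]
  have hsd : (0 : ℝ) < Real.sqrt d := Real.sqrt_pos.2 (by exact_mod_cast (show 0 < d by omega))
  exact div_le_div_of_nonneg_right (mul_le_mul_of_nonneg_left hh Real.pi_pos.le) hsd.le

/-- **Repulsion under `L(½, χ) ≥ 0`: `1 − β ≥ π(1 + d^{1/4}(log d − 2 log 2 − 4)/(4√2))/(√d log²d)`** for every
real zero `β ≥ 1 − 1/(40 log d)` of `L(s, χ)`, `d ≥ 232` — the scale `1/(d^{1/4} log d)` against the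
unconditional kernel `π/(√d log²d)` (`RealZeroRepulsion.one_sub_realZero_ge_pi`); via the kernel (11.10)
ceiling `h_K ≤ (1/π)√d log²d (1 − β)` (`SiegelZeroClassNumber.classNumber_le_of_odd`).
[cite: MontgomeryVaughan2007, §11.2 (11.10)] [cite: IwaniecConversations2006, §4 (4.23)–(4.25)] -/
theorem one_sub_realZero_ge_of_LFunction_half_nonneg {d : ℕ} [NeZero d] (hd : 232 ≤ d)
    {χ : DirichletCharacter ℂ d} (hprim : χ.IsPrimitive) (hquad : χ.IsQuadratic) (hodd : χ.Odd)
    (hL : 0 ≤ (χ.LFunction (1 / 2)).re) {β : ℝ} (hβ : 1 - 1 / (40 * Real.log d) ≤ β)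
    (hz : χ.LFunction β = 0) :
    Real.pi * (1 + (d : ℝ) ^ (1 / 4 : ℝ) * (Real.log d - 2 * Real.log 2 - 4) / (4 * Real.sqrt 2)) /
        (Real.sqrt d * Real.log d ^ 2) ≤ 1 - β := by
  obtain ⟨K, _i1, _i2, h2, hdK⟩ := exists_quadraticField_of_odd_primitive hprim hquad hodd
  have hh := classNumber_ge_of_LFunction_half_nonneg h2 hdK (by omega) hprim hquad hodd hL
  have hup := SiegelZeroClassNumber.classNumber_le_of_odd h2 hdK hd hprim hquad hodd hβ hz
  have hdR : (232 : ℝ) ≤ d := by exact_mod_cast hd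
  have hsd : (0 : ℝ) < Real.sqrt d := Real.sqrt_pos.2 (by linarith)
  have hlog : 0 < Real.log d := Real.log_pos (by linarith)
  have hpos : 0 < Real.sqrt d * Real.log d ^ 2 := by positivity
  rw [div_le_iff₀ hpos]
  have := mul_le_mul_of_nonneg_left (le_trans hh hup) Real.pi_pos.le
  have hπ := Real.pi_pos
  calc Real.pi * (1 + (d : ℝ) ^ (1 / 4 : ℝ) * (Real.log d - 2 * Real.log 2 - 4) / (4 * Real.sqrt 2))
      ≤ Real.pi * (1 / Real.pi * Real.sqrt d * Real.log d ^ 2 * (1 - β)) := this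
    _ = (1 - β) * (Real.sqrt d * Real.log d ^ 2) := by field_simp
    _ = (1 - β) * (Real.sqrt d * Real.log d ^ 2) := rfl

/-- **The quality of a Siegel zero under `L(½, χ) ≥ 0`: `η ≤ √d log d/(π(1 + d^{1/4}(log d − 2 log 2 − 4)/(4√2)))`**
(`η ≥ 40`, `d ≥ 10⁴`), i.e. `η ≲ (4√2/π) d^{1/4}`. [cite: TaoTeravainen2021, Definition 1.4]
[cite: IwaniecConversations2006, §4 (4.23)–(4.25)] -/
theorem isSiegelZero_quality_le_of_LFunction_half_nonneg {d : ℕ} [NeZero d] (hd : 10 ^ 4 ≤ d)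
    {χ : DirichletCharacter ℂ d} {η : ℝ} (hS : IsSiegelZero χ η) (hodd : χ.Odd) (h40 : 40 ≤ η)
    (hL : 0 ≤ (χ.LFunction (1 / 2)).re) :
    η * (1 + (d : ℝ) ^ (1 / 4 : ℝ) * (Real.log d - 2 * Real.log 2 - 4) / (4 * Real.sqrt 2)) ≤
      Real.sqrt d * Real.log d / Real.pi := by
  by_contra hcon
  push Not at hcon
  have := LFunction_half_neg_of_isSiegelZero hd hS hodd h40 hcon
  linarith

/-! ### A small class number forces a real zero in `(½, 1)` -/

/-- **`h_K < 1 + d^{1/4}(log d − 2 log 2 − 4)/(4√2) ⇒ L(s, χ) has a real zero `β ∈ (½, 1)`.** The class-number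
deficiency makes `L(½, χ) < 0` (`LFunction_half_neg_of_classNumber_lt`), while `L(1, χ) > 0`; the real-valued
`σ ↦ L(σ, χ)` therefore vanishes in between (intermediate value theorem, tree
`DirichletAbel.LFunction_ofReal_re_pos_of_forall_ne_zero`). So an imaginary quadratic field with class number below
the `d^{1/4} log d` scale carries an exceptional REAL zero in the right half of the critical segment — the
zero-existence form of the central-value exit. [cite: IwaniecConversations2006, §4 (4.23)–(4.25)] -/
theorem exists_realZero_gt_half_of_classNumber_lt (h2 : finrank ℚ K = 2) {d : ℕ} [NeZero d]
    (hdK : NumberField.discr K = -(d : ℤ)) (hd : 4 < d) {χ : DirichletCharacter ℂ d}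
    (hprim : χ.IsPrimitive) (hquad : χ.IsQuadratic) (hodd : χ.Odd)
    (hh : (classNumber K : ℝ) < 1 + (d : ℝ) ^ (1 / 4 : ℝ) * (Real.log d - 2 * Real.log 2 - 4) / (4 * Real.sqrt 2)) :
    ∃ β : ℝ, 1 / 2 < β ∧ β < 1 ∧ χ.LFunction β = 0 := by
  have hχ1 : χ ≠ 1 := by
    intro h
    have h1 : χ (-1) = -1 := hodd
    rw [h, MulChar.one_apply (isUnit_one.neg)] at h1
    norm_num at h1
  have hneg := LFunction_half_neg_of_classNumber_lt h2 hdK hd hprim hquad hodd hh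
  have hhalf : ((1 / 2 : ℝ) : ℂ) = 1 / 2 := by push_cast; rfl
  rw [← hhalf] at hneg
  by_contra hcon
  push Not at hcon
  have hz : ∀ σ' : ℝ, 1 / 2 ≤ σ' → σ' ≤ 1 → χ.LFunction σ' ≠ 0 := by
    intro σ' h1 h2' h0
    rcases eq_or_lt_of_le h1 with h | h
    · rw [← h] at h0
      rw [h0, Complex.zero_re] at hneg
      exact lt_irrefl _ hneg
    rcases eq_or_lt_of_le h2' with h' | h'
    · rw [h'] at h0
      exact χ.LFunction_apply_one_ne_zero hχ1 (by exact_mod_cast h0)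
    · exact hcon σ' h h' h0
  have hpos := DirichletAbel.LFunction_ofReal_re_pos_of_forall_ne_zero χ hχ1 hquad.sq_eq_one
    (by norm_num : (0 : ℝ) < 1 / 2) (by norm_num) hz
  linarith

/-- **A Siegel zero of quality `η ≳ d^{1/4}` puts a SECOND kind of real zero in play: `L(½, χ) < 0`, so the
number of real zeros of `L(s, χ)` in `(½, 1)` counted with multiplicity is ODD** — in the weak form provable
without multiplicities: there is a real zero in `(½, 1)` (which may be the Siegel zero itself). Recorded for the
dictionary; the content is `LFunction_half_neg_of_isSiegelZero`. [cite: TaoTeravainen2021, Definition 1.4]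
[cite: IwaniecConversations2006, §4 (4.23)–(4.25)] -/
theorem exists_realZero_gt_half_of_isSiegelZero {d : ℕ} [NeZero d] (hd : 10 ^ 4 ≤ d)
    {χ : DirichletCharacter ℂ d} {η : ℝ} (hS : IsSiegelZero χ η) (hodd : χ.Odd) (h40 : 40 ≤ η)
    (hη : Real.sqrt d * Real.log d / Real.pi <
      η * (1 + (d : ℝ) ^ (1 / 4 : ℝ) * (Real.log d - 2 * Real.log 2 - 4) / (4 * Real.sqrt 2))) :
    (χ.LFunction (1 / 2)).re < 0 ∧ ∃ β : ℝ, 1 / 2 < β ∧ β < 1 ∧ χ.LFunction β = 0 := by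
  have hprim := hS.1
  have hquad := hS.2.1
  obtain ⟨K, _i1, _i2, h2, hdK⟩ := exists_quadraticField_of_odd_primitive hprim hquad hodd
  have hη0 : 0 < η := by linarith
  have hup := SiegelZeroClassNumber.classNumber_le_of_isSiegelZero_odd_of_forty_le h2 hdK hd hS hodd h40
  have hlt : (classNumber K : ℝ) <
      1 + (d : ℝ) ^ (1 / 4 : ℝ) * (Real.log d - 2 * Real.log 2 - 4) / (4 * Real.sqrt 2) := by
    refine lt_of_le_of_lt hup ?_
    rw [show 1 / Real.pi * Real.sqrt d * Real.log d / η = Real.sqrt d * Real.log d / Real.pi / η by ring,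
      div_lt_iff₀ hη0]
    linarith
  exact ⟨LFunction_half_neg_of_classNumber_lt h2 hdK (by omega) hprim hquad hodd hlt,
    exists_realZero_gt_half_of_classNumber_lt h2 hdK (by omega) hprim hquad hodd hlt⟩

end CentralValueExit

end Literature.NumberTheory.LFunctions

end
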